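import Summits.QuantumFields.BalabanUV.Beta.CombMixedT2EvenSiteLetter
import Summits.QuantumFields.BalabanUV.Beta.CombWilsonT2Periodised
import Summits.QuantumFields.BalabanUV.Beta.FP.PeriodisedBorderTablesRecord

/-!
# `BalabanUV.Beta.CombMixedT2EvenPeriodised` — binder row D1 ∕ (C1), PART 26: **(K2b) AT DEPTH 1 ON THE TORUS — THE COARSE-SLOT-PERIODISED EVEN MIXED TABLE ALONG A TORUS
# PURE GAUGE IN ITS FINE BOND IS `wM2_j •` THE COMMUTATOR OF THE PERIODISED CONSTRAINT HESSIAN OF THE COARSE BOND WITH THE DIAGONAL GAUGE GENERATOR**: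
# `Σ_b (Dλ)_b • ℳ̂₂ᵉ^{b,β}|ff = wM2_j • (Ĥ_β|ff · E_λ − E_λ · Ĥ_β|ff)`, `Ĥ_β := perF M (dper M (symHessFFAt ρ_c Lc β))`, `E_λ := diagonal (λ b.1)` — NO remainder word, NO Λ-lock —
# the mixed twin of an2 g42's `CombWilsonT2Periodised` §3 (`torus_H2_pureGauge_fst_fun`) and of leaf-02's `FP/PeriodisedSymBorderT2IndexWard` §3, fed PART 25's per-site
# letter `CombMixedT2EvenSiteLetter.sum_mixedT2_even_sub_inl_inl` through an2's period-lattice engine `sum_tgrad_mul_perZ_dper_of_indexLaw_periodCov` on the `(inl, inl)` block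

WHY (journal [AN2-G70-ONLINE]∕A-1, J-NOTE-12 §3∕§3-ADD, road FP [D1P3-G45-A2] «K2Λ WANTED», request R-AN2-69-K2L).  (J-Λ₂′) — the lv-free core of v5's displayed (J-Λ₂) — factors through
(K2b) `Σ_b (Dλ)_b • ℳ̂₂ᵉ(b,β)|ff = κ₂ • [E_λ, Ĉ″_β]` ∘ (K1′) ∘ one lock.  PART 25 gave (K2b) per fine site for the EVEN table at the lattice level (pure commutator); this file is its torus
realisation at depth 1, in the letters of PART 24's mixed torus word `ℳ̂₂ᵉ(b,β) = perF M (dper M (x z ↦ Σ'_n M2ᵉ b.2 ↑b.1 β.2 (β.1 + M′∘n) x z))` (second slot = COARSE multiplier bond, its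
COARSE-period copies summed; first slot = fine field bond on the torus of the box `M = Lc·M′`; `Ĉ″_β` = `Ĥ_β` at depth 1 by `CompositeOneShotJets.compH_one`, `wM2_0 = 1`).

WHAT (`d = 3`, centred root `ρ_c = ctr 4 Lc`, any level `j`, any box with `M = Lc·M′`; [folklore] re-indexing of finitely supported sums BY NAME; no `def`, no `def … : Prop`,
nothing cited, 0 sorry):
* §1 letters of the even table `M2ᵉ κ u ρ′ w := ½•(M2Of 3 Lc (symMixFFAt ρ_c Lc) j κ u ρ′ w + sgnK (trK (…)))` on `(inl α, inl γ)`: the entry (`mixedT2_even_inl_inl`), the three FINITE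
  supports (left leg `x`, right leg `z`, fine bond `u` — all `Near Lc w`, an1's `symTTab_eq_zero₁∕₂∕₃`), the window geometry (`sub_mem_cube_of_near_near`, `smul_sub_mem_cube_of_near`),
  and the joint block covariance `mixedT2_even_translate` (`symMixFFAt_translate`; `sgnK ∘ trK` commute with `shiftK`).
* §2 the COARSE-SLOT-PERIODISED even bi-family `hV : V = fun κ u x z a c => Σ'_n M2ᵉ κ u ρ′ (w + M′∘n) x z a c`: `summable_mixedT2_even_translate_inl_inl`, `mixedT2per_even_periodCov`
  (joint invariance under the period lattice of `M`), windows `mixedT2per_even_inl_inl_eq_zero_of_not_mem_T ∕ _S`, `dper_symHessFFAt_inl_inl_eq_zero_of_not_mem` (`hqS`), and the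
  first-slot law in the engine's `hlaw` shape **`sum_mixedT2per_even_sub_inl_inl`**: `Σ_κ (V κ (w₀ − e_κ) − V κ w₀) x z (inl α) (inl γ) = ([x = w₀] − [z = w₀]) · ((−wM2_j) • dper M
  (symHessFFAt ρ_c Lc ρ′ w)) x z (inl α) (inl γ)` (PART 25 §3 per copy; `Σ'_n symHessFFAt ρ′ (w + M′∘n) = dper M (symHessFFAt ρ′ w)` by leaf-02's `dper_apply_of_siteCov`).
* §3 **`sum_tgrad_mul_perZ_dper_mixedT2per_even`** (the engine applied, entrywise), **`torus_M2even_pureGauge_fst`** (`Σ_b tgrad M (b.1, inl b.2) s • ℳ₂ᵉ^{b,β}|ff = wM2_j • (Ĥ_β|ff * E_s −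
  E_s * Ĥ_β|ff)`, `E_s := diagonal (tdelta M b.1 s)`) and **`torus_M2even_pureGauge_fst_fun`** (along any torus gauge FUNCTION `λ`, `(Dλ)_b := Σ_s tgrad M (b.1, inl b.2) s · λ s`,
  `E_λ := diagonal (λ b.1)`) — (K2b) at depth 1 with `κ₂ = −wM2_j` against `[E_λ, Ĥ_β]`.
WHAT THIS IS NOT: not depth ≥ 2 (v5's smallest instance `n = 0` is composite depth 2; the composite mixed table `CompositeMixedTable.compMixKer_succ` needs its own Ward induction);
not (K1′), not the lock, not (J-Λ₂′) itself; no weight of the literal fixed beyond `wM2_j` (`M2Of_apply`); nothing of Bałaban's asserted, valued or discharged; 0 estimates; 0∕4 row-D1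
binders (hW, hR, D1Tel, D1Rep); ROOT M‴ p325680 ∕ P5c ∕ D6 untouched; NOT (C1), NOT (T-ID), NOT D1, NEVER «G-an2-4 closed», NOT BetaPertH, NOT continuum, NOT Clay.

HONEST DEPENDENCY (page 1, mandatory): continuum YM on T⁴ ⇐ BetaPertH ∧ nine spine estimates (0/9 proved); BetaPertH ⇐ (D1) ∧ (D4) ∧ CAP+tail;
G-an2-4 gates asym, D1 and NE2/3/4.  HONEST FRAMING (cell contract, verbatim): «discharging `BetaPertH` makes Bałaban's UV stability UNCONDITIONAL —
a real constructive-QFT result; it is NOT the continuum limit and NOT the Clay problem.»  ABSOLUTE RULE (cell charter, verbatim): «No internally-minted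
statement may enter as a cited fact. Every hypothesis is either kernel-proved in this package or a verbatim quotation of a PUBLISHED theorem with page
reference. The manuscript(s) under audit are NOT citable for their own disputed steps — they are the thing under adjudication; programme-internal
(2001/route/tribunal) claims are never citable.»  Row D1 ∕ (C1) OWNER an2 (b2b-balaban-beta-an2) gen 70, 2026-08-28.  §2∕§3 shaped on leaf-02 g22's
`FP/PeriodisedSymBorderT2IndexWard` §2∕§3 (same engine, mixed letters).  No existing file touched.
-/

noncomputable section

open scoped BigOperators

namespace Summit.QuantumFields.BalabanUV.Beta.CombMixedT2EvenPeriodised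

open Finset Matrix
open Literature.MathematicalPhysics.QuantumFieldTheory
open Literature.MathematicalPhysics.QuantumFieldTheory.Balaban1983to89
open Literature.MathematicalPhysics.QuantumFieldTheory.Balaban1983to89.Beta
open B4TorusKernel.MultiPeriod (translate translate_apply)
open B4Reflection242 (translate_translate)
open B6Lemma24Torus (pbox mem_pbox)
open ExpKernelCalculus (MKer shiftK comp)
open AffineAveraging (Site box toSite unitVec)
open AveragingContoursRooted (ctr ctrOff ctrOff_mem_box)
open AveragingHessianKernels (Bond Near)
open OneStepResolventKernel (Fib)
open BalabanStepW2 (M2Of wM2)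
open Summit.QuantumFields.BalabanUV.Beta.TameKernelCalculus (trK trK_apply)
open Summit.QuantumFields.BalabanUV.Beta.BorderedHessian (sgnK sgnK_apply sgnF_inl)
open Summit.QuantumFields.BalabanUV.Beta.AxialDressingRooted (cube mem_cube one_le_of_neZero)
open Summit.QuantumFields.BalabanUV.Beta.WardLocusParityLevels (M2Of_apply)
open Summit.QuantumFields.BalabanUV.Beta.SymAveragingHessianCounts (symHessFFAt symHessKerAt symHessFFAt_inl_inl symHessFFAt_translate symHessKerAt_eq_zero_left
  symHessKerAt_eq_zero_right)
open Summit.QuantumFields.BalabanUV.Beta.SymAveragingMixedJetTables (symMixFFAt symMixKerAt symMixFFAt_inl_inl symMixFFAt_translate symTTab_eq_zero₁ symTTab_eq_zero₂ symTTab_eq_zero₃)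
open Summit.QuantumFields.BalabanUV.Beta.CombMixedT2EvenSiteLetter (sum_mixedT2_even_sub_inl_inl)
open Summit.QuantumFields.BalabanUV.Beta.FP.KernelPeriodisationFib (Idx perF perF_apply perZ perZ_apply perZ_smul translate_eq_add)
open Summit.QuantumFields.BalabanUV.Beta.FP.KernelPeriodisationFibLoc (dper dper_apply)
open Summit.QuantumFields.BalabanUV.Beta.FP.TorusGaugeCovariance (tdelta tgrad nearBox mem_nearBox)
open Summit.QuantumFields.BalabanUV.Beta.FP.TorusGaugeCovariancePairing (sum_tdelta_mul wrapPt_of_mem)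
open Summit.QuantumFields.BalabanUV.Beta.FP.PeriodisedBorderIndexWard (translate_injective)
open Summit.QuantumFields.BalabanUV.Beta.FP.PeriodisedBorderTables (translate_eq_add_smul)
open Summit.QuantumFields.BalabanUV.Beta.FP.PeriodisedBorderTablesRecord (dper_apply_of_siteCov)
open Summit.QuantumFields.BalabanUV.Beta.CombWilsonT2Periodised (sum_tgrad_mul_perZ_dper_of_indexLaw_periodCov translate_eq_translate_sub_add)

variable {Lc : ℕ} [NeZero Lc]

/-! ## §1 Letters of the even mixed table `M2ᵉ` on the `(inl, inl)` block: entry, supports, window geometry, covariance -/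

section Letters

variable (j : ℕ)

omit [NeZero Lc] in
/-- [folklore] **THE `(inl α, inl γ)` ENTRY OF THE EVEN MIXED TABLE**: `M2ᵉ κ u ρ′ w x z (inl α) (inl γ) = ½·wM2_j·(t_sym(w; (κ,u); (α,x),(γ,z)) + t_sym(w; (κ,u); (γ,z),(α,x)))`
(`M2Of_apply`, `symMixFFAt_inl_inl`, `sgnF (inl ·) = 1`). -/
theorem mixedT2_even_inl_inl (κ : Fin 4) (u : Site 4) (ρ' : Fin 4) (w x z : Site 4) (α γ : Fin 4) :
    ((1 / 2 : ℝ) • (M2Of 3 Lc (symMixFFAt (ctr 4 Lc) Lc) j κ u ρ' w + sgnK (trK (M2Of 3 Lc (symMixFFAt (ctr 4 Lc) Lc) j κ u ρ' w)))) x z (Sum.inl α) (Sum.inl γ)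
      = (1 / 2 : ℝ) * wM2 3 Lc j * (symMixKerAt (ctr 4 Lc) Lc ρ' w (κ, u) (α, x) (γ, z) + symMixKerAt (ctr 4 Lc) Lc ρ' w (κ, u) (γ, z) (α, x)) := by
  simp only [Pi.smul_apply, Pi.add_apply, smul_eq_mul, sgnK_apply, trK_apply, sgnF_inl, M2Of_apply, symMixFFAt_inl_inl]
  ring

/-- [folklore] an1's sym mixed kernel vanishes when its LEFT fluctuation leg is off the support box of the coarse bond (`symTTab_eq_zero₁`, box root). -/
theorem symMixKerAt_eq_zero_of_not_near_left {L : ℕ} {r : Fin 4 → ℕ} (hr : r ∈ box 4 L) (μ : Fin 4) (y : Site 4) (g : Bond 4) {f : Bond 4}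
    (h : ¬ Near L y f.2) (f' : Bond 4) : symMixKerAt (toSite r) L μ y g f f' = 0 := by
  unfold symMixKerAt
  rw [symTTab_eq_zero₁ hr μ y h]
  push_cast
  rfl

/-- [folklore] … or when its RIGHT fluctuation leg is off the box (`symTTab_eq_zero₂`). -/
theorem symMixKerAt_eq_zero_of_not_near_right {L : ℕ} {r : Fin 4 → ℕ} (hr : r ∈ box 4 L) (μ : Fin 4) (y : Site 4) (g f : Bond 4) {f' : Bond 4}
    (h : ¬ Near L y f'.2) : symMixKerAt (toSite r) L μ y g f f' = 0 := by
  unfold symMixKerAt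
  rw [symTTab_eq_zero₂ hr μ y _ h]
  push_cast
  rfl

/-- [folklore] … or when its BACKGROUND (fine field) bond is off the box (`symTTab_eq_zero₃`). -/
theorem symMixKerAt_eq_zero_of_not_near_bond {L : ℕ} {r : Fin 4 → ℕ} (hr : r ∈ box 4 L) (μ : Fin 4) (y : Site 4) {g : Bond 4} (h : ¬ Near L y g.2)
    (f f' : Bond 4) : symMixKerAt (toSite r) L μ y g f f' = 0 := by
  unfold symMixKerAt
  rw [symTTab_eq_zero₃ hr μ y _ _ h]
  push_cast
  rfl

/-- [folklore] LEFT-LEG support of the even table's `ff` entries (centred root): zero unless `Near Lc w x`. -/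
theorem mixedT2_even_inl_inl_eq_zero_of_not_near_left (κ : Fin 4) (u : Site 4) (ρ' : Fin 4) (w : Site 4) {x : Site 4} (hx : ¬ Near Lc w x) (z : Site 4) (α γ : Fin 4) :
    ((1 / 2 : ℝ) • (M2Of 3 Lc (symMixFFAt (ctr 4 Lc) Lc) j κ u ρ' w + sgnK (trK (M2Of 3 Lc (symMixFFAt (ctr 4 Lc) Lc) j κ u ρ' w)))) x z (Sum.inl α) (Sum.inl γ) = 0 := by
  have hLc : 1 ≤ Lc := one_le_of_neZero Lc
  rw [mixedT2_even_inl_inl, show ctr 4 Lc = toSite (ctrOff 4 Lc) from rfl,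
    symMixKerAt_eq_zero_of_not_near_left (ctrOff_mem_box hLc) ρ' w _ (f := (α, x)) hx,
    symMixKerAt_eq_zero_of_not_near_right (ctrOff_mem_box hLc) ρ' w _ _ (f' := (α, x)) hx]
  ring

/-- [folklore] RIGHT-LEG support: zero unless `Near Lc w z`. -/
theorem mixedT2_even_inl_inl_eq_zero_of_not_near_right (κ : Fin 4) (u : Site 4) (ρ' : Fin 4) (w x : Site 4) {z : Site 4} (hz : ¬ Near Lc w z) (α γ : Fin 4) :
    ((1 / 2 : ℝ) • (M2Of 3 Lc (symMixFFAt (ctr 4 Lc) Lc) j κ u ρ' w + sgnK (trK (M2Of 3 Lc (symMixFFAt (ctr 4 Lc) Lc) j κ u ρ' w)))) x z (Sum.inl α) (Sum.inl γ) = 0 := by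
  have hLc : 1 ≤ Lc := one_le_of_neZero Lc
  rw [mixedT2_even_inl_inl, show ctr 4 Lc = toSite (ctrOff 4 Lc) from rfl,
    symMixKerAt_eq_zero_of_not_near_right (ctrOff_mem_box hLc) ρ' w _ _ (f' := (γ, z)) hz,
    symMixKerAt_eq_zero_of_not_near_left (ctrOff_mem_box hLc) ρ' w _ (f := (γ, z)) hz]
  ring

/-- [folklore] FINE-BOND (family index) support: zero unless `Near Lc w u`. -/
theorem mixedT2_even_inl_inl_eq_zero_of_not_near_bond (κ : Fin 4) {u : Site 4} (ρ' : Fin 4) (w : Site 4) (hu : ¬ Near Lc w u) (x z : Site 4) (α γ : Fin 4) :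
    ((1 / 2 : ℝ) • (M2Of 3 Lc (symMixFFAt (ctr 4 Lc) Lc) j κ u ρ' w + sgnK (trK (M2Of 3 Lc (symMixFFAt (ctr 4 Lc) Lc) j κ u ρ' w)))) x z (Sum.inl α) (Sum.inl γ) = 0 := by
  have hLc : 1 ≤ Lc := one_le_of_neZero Lc
  rw [mixedT2_even_inl_inl, show ctr 4 Lc = toSite (ctrOff 4 Lc) from rfl,
    symMixKerAt_eq_zero_of_not_near_bond (ctrOff_mem_box hLc) ρ' w (g := (κ, u)) hu,
    symMixKerAt_eq_zero_of_not_near_bond (ctrOff_mem_box hLc) ρ' w (g := (κ, u)) hu]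
  ring

omit [NeZero Lc] in
/-- [folklore] WINDOW GEOMETRY: two sites near the same coarse bond differ by a vector of the cube of radius `2L` (`|x_i − t_i| ≤ 2L − 1`). -/
theorem sub_mem_cube_of_near_near {L : ℕ} {y x t : Site 4} (hx : Near L y x) (ht : Near L y t) : x - t ∈ cube (3 + 1) (2 * L) := by
  refine mem_cube.2 fun i => ?_
  have h1 := hx i
  have h2 := ht i
  rw [Pi.sub_apply, abs_le]
  push_cast
  constructor <;> linarith [h1.1, h1.2, h2.1, h2.2]

omit [NeZero Lc] in
/-- [folklore] WINDOW GEOMETRY: a site near the coarse bond at `y` sees `L•y` inside its cube of radius `2L` (`0 ≤ x_i − L·y_i ≤ 2L − 1`). -/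
theorem smul_sub_mem_cube_of_near {L : ℕ} {y x : Site 4} (hx : Near L y x) : x - (L : ℤ) • y ∈ cube (3 + 1) (2 * L) := by
  refine mem_cube.2 fun i => ?_
  have h1 := hx i
  rw [Pi.sub_apply, Pi.smul_apply, smul_eq_mul, abs_le]
  push_cast
  constructor <;> linarith [h1.1, h1.2]

omit [NeZero Lc] in
/-- [folklore] **JOINT BLOCK COVARIANCE OF THE EVEN TABLE** (an1's (Tmix) `symMixFFAt_translate`; `sgnK`, `trK`, scalars commute with `shiftK`):
`M2ᵉ κ (u + Lc•t) ρ′ (w + t) (x + Lc•t) (z + Lc•t) a c = M2ᵉ κ u ρ′ w x z a c`. -/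
theorem mixedT2_even_translate (κ : Fin 4) (u : Site 4) (ρ' : Fin 4) (w t x z : Site 4) (a c : Fib 3) :
    ((1 / 2 : ℝ) • (M2Of 3 Lc (symMixFFAt (ctr 4 Lc) Lc) j κ (u + (Lc : ℤ) • t) ρ' (w + t)
        + sgnK (trK (M2Of 3 Lc (symMixFFAt (ctr 4 Lc) Lc) j κ (u + (Lc : ℤ) • t) ρ' (w + t))))) (x + (Lc : ℤ) • t) (z + (Lc : ℤ) • t) a c
      = ((1 / 2 : ℝ) • (M2Of 3 Lc (symMixFFAt (ctr 4 Lc) Lc) j κ u ρ' w + sgnK (trK (M2Of 3 Lc (symMixFFAt (ctr 4 Lc) Lc) j κ u ρ' w)))) x z a c := by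
  simp only [Pi.smul_apply, Pi.add_apply, smul_eq_mul, sgnK_apply, trK_apply, M2Of_apply, symMixFFAt_translate]
  simp only [shiftK, add_neg_cancel_right]

end Letters

/-! ## §2 The coarse-slot-periodised even mixed bi-family: copies, period covariance, windows, the first-slot law in `hlaw` shape -/

section Family

variable {M M' : Fin 4 → ℕ} [∀ μ, NeZero (M μ)] [∀ μ, NeZero (M' μ)] (j : ℕ) (ρ' : Fin 4) (w : Site 4)
  {V : Fin 4 → Site 4 → MKer 4 (Fib 3)}

omit [∀ μ, NeZero (M μ)] in
/-- [folklore] the COARSE-period copies of the multiplier bond whose support box contains a given fluctuation site are finitely many: on the `(inl, inl)` block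
`n ↦ M2ᵉ κ u ρ′ (w + M′∘n) x z (inl α) (inl γ)` is summable (left-leg support `Near Lc (w + M′∘n) x`; `n ↦ Lc•(w + M′∘n)` injective). -/
theorem summable_mixedT2_even_translate_inl_inl (κ : Fin 4) (u x z : Site 4) (α γ : Fin 4) :
    Summable fun n : Site 4 =>
      ((1 / 2 : ℝ) • (M2Of 3 Lc (symMixFFAt (ctr 4 Lc) Lc) j κ u ρ' (translate M' w n)
          + sgnK (trK (M2Of 3 Lc (symMixFFAt (ctr 4 Lc) Lc) j κ u ρ' (translate M' w n))))) x z (Sum.inl α) (Sum.inl γ) := by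
  have hLc : (Lc : ℤ) ≠ 0 := by exact_mod_cast NeZero.ne Lc
  have hinj : Function.Injective fun n : Site 4 => (Lc : ℤ) • translate M' w n :=
    (smul_right_injective (Site 4) hLc).comp (translate_injective (M := M') w)
  refine summable_of_ne_finset_zero (s := ((cube (3 + 1) (2 * Lc)).image (fun v => x - v)).preimage _ hinj.injOn) fun n hn => ?_
  refine mixedT2_even_inl_inl_eq_zero_of_not_near_left j κ u ρ' _ (fun hnear => hn (Finset.mem_preimage.2 ?_)) z α γ
  exact Finset.mem_image.2 ⟨x - (Lc : ℤ) • translate M' w n, smul_sub_mem_cube_of_near hnear, sub_sub_cancel _ _⟩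

omit [NeZero Lc] [∀ μ, NeZero (M μ)] [∀ μ, NeZero (M' μ)] in
/-- [folklore] **JOINT INVARIANCE UNDER THE PERIOD LATTICE OF `M = Lc·M′`** of the coarse-slot-periodised even bi-family `V κ u := Σ'_n M2ᵉ κ u ρ′ (w + M′∘n)`:
`V κ (u + M∘m) (x + M∘m) (z + M∘m) = V κ u x z` (§1's `mixedT2_even_translate` per copy with `t := M′∘m`, re-indexing `n ↦ n − m`; no convergence needed). -/
theorem mixedT2per_even_periodCov (hM : ∀ i, M i = Lc * M' i)
    (hV : V = fun κ u x z a c => ∑' n : Site 4,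
      ((1 / 2 : ℝ) • (M2Of 3 Lc (symMixFFAt (ctr 4 Lc) Lc) j κ u ρ' (translate M' w n)
          + sgnK (trK (M2Of 3 Lc (symMixFFAt (ctr 4 Lc) Lc) j κ u ρ' (translate M' w n))))) x z a c)
    (κ : Fin 4) (u m x z : Site 4) (a c : Fib 3) :
    V κ (translate M u m) (translate M x m) (translate M z m) a c = V κ u x z a c := by
  subst hV
  show (∑' n : Site 4, ((1 / 2 : ℝ) • (M2Of 3 Lc (symMixFFAt (ctr 4 Lc) Lc) j κ (translate M u m) ρ' (translate M' w n)
          + sgnK (trK (M2Of 3 Lc (symMixFFAt (ctr 4 Lc) Lc) j κ (translate M u m) ρ' (translate M' w n))))) (translate M x m) (translate M z m) a c)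
      = ∑' n : Site 4, ((1 / 2 : ℝ) • (M2Of 3 Lc (symMixFFAt (ctr 4 Lc) Lc) j κ u ρ' (translate M' w n)
          + sgnK (trK (M2Of 3 Lc (symMixFFAt (ctr 4 Lc) Lc) j κ u ρ' (translate M' w n))))) x z a c
  rw [← (Equiv.subRight m).tsum_eq fun n => ((1 / 2 : ℝ) • (M2Of 3 Lc (symMixFFAt (ctr 4 Lc) Lc) j κ u ρ' (translate M' w n)
          + sgnK (trK (M2Of 3 Lc (symMixFFAt (ctr 4 Lc) Lc) j κ u ρ' (translate M' w n))))) x z a c]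
  refine tsum_congr fun n => ?_
  rw [Equiv.subRight_apply, translate_eq_add_smul hM u m, translate_eq_add_smul hM x m, translate_eq_add_smul hM z m,
    translate_eq_translate_sub_add M' w n m]
  exact mixedT2_even_translate j κ u ρ' (translate M' w (n - m)) (fun i => (M' i : ℤ) * m i) x z a c

omit [∀ μ, NeZero (M μ)] [∀ μ, NeZero (M' μ)] in
/-- [folklore] window letter `hT` (fine bond = family index): on the `(inl, inl)` block `V κ u x z` vanishes unless `u ∈ x − cube (2Lc)` (a copy carrying both `x` and `u` in its
support box puts them within `2Lc − 1` of each other). -/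
theorem mixedT2per_even_inl_inl_eq_zero_of_not_mem_T
    (hV : V = fun κ u x z a c => ∑' n : Site 4,
      ((1 / 2 : ℝ) • (M2Of 3 Lc (symMixFFAt (ctr 4 Lc) Lc) j κ u ρ' (translate M' w n)
          + sgnK (trK (M2Of 3 Lc (symMixFFAt (ctr 4 Lc) Lc) j κ u ρ' (translate M' w n))))) x z a c)
    (κ : Fin 4) (x z : Site 4) (α γ : Fin 4) :
    ∀ u ∉ (cube (3 + 1) (2 * Lc)).image (fun v => x - v), V κ u x z (Sum.inl α) (Sum.inl γ) = 0 := fun u hu => by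
  subst hV
  refine (tsum_congr fun n => ?_).trans tsum_zero
  by_cases hx : Near Lc (translate M' w n) x
  · exact mixedT2_even_inl_inl_eq_zero_of_not_near_bond j κ ρ' _
      (fun hu' => hu (Finset.mem_image.2 ⟨x - u, sub_mem_cube_of_near_near hx hu', sub_sub_cancel x u⟩)) x z α γ
  · exact mixedT2_even_inl_inl_eq_zero_of_not_near_left j κ u ρ' _ hx z α γ

omit [∀ μ, NeZero (M μ)] [∀ μ, NeZero (M' μ)] in
/-- [folklore] window letter `hS` (right fluctuation leg): on the `(inl, inl)` block `V κ u x z` vanishes unless `z ∈ x − cube (2Lc)`. -/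
theorem mixedT2per_even_inl_inl_eq_zero_of_not_mem_S
    (hV : V = fun κ u x z a c => ∑' n : Site 4,
      ((1 / 2 : ℝ) • (M2Of 3 Lc (symMixFFAt (ctr 4 Lc) Lc) j κ u ρ' (translate M' w n)
          + sgnK (trK (M2Of 3 Lc (symMixFFAt (ctr 4 Lc) Lc) j κ u ρ' (translate M' w n))))) x z a c)
    (κ : Fin 4) (u x : Site 4) (α γ : Fin 4) :
    ∀ z ∉ (cube (3 + 1) (2 * Lc)).image (fun v => x - v), V κ u x z (Sum.inl α) (Sum.inl γ) = 0 := fun z hz => by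
  subst hV
  refine (tsum_congr fun n => ?_).trans tsum_zero
  by_cases hx : Near Lc (translate M' w n) x
  · exact mixedT2_even_inl_inl_eq_zero_of_not_near_right j κ u ρ' _ x
      (fun hz' => hz (Finset.mem_image.2 ⟨x - z, sub_mem_cube_of_near_near hx hz', sub_sub_cancel x z⟩)) α γ
  · exact mixedT2_even_inl_inl_eq_zero_of_not_near_left j κ u ρ' _ hx z α γ

omit [∀ μ, NeZero (M μ)] [∀ μ, NeZero (M' μ)] in
/-- [folklore] the contact kernel's window (`hqS`): the COARSE-slot-periodised constraint Hessian `dper M (symHessFFAt ρ_c Lc ρ′ w)` (`= Σ'_n symHessFFAt ρ′ (w + M′∘n)`, leaf-02's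
`dper_apply_of_siteCov` with (TH) `symHessFFAt_translate`, `M = Lc·M′`) vanishes on `(inl, inl)` unless `z ∈ x − cube (2Lc)`; so does any scalar multiple. -/
theorem dper_symHessFFAt_inl_inl_eq_zero_of_not_mem (hM : ∀ i, M i = Lc * M' i) (c : ℝ) (x : Site 4) (α γ : Fin 4) :
    ∀ z ∉ (cube (3 + 1) (2 * Lc)).image (fun v => x - v), (c • dper M (symHessFFAt (ctr 4 Lc) Lc ρ' w)) x z (Sum.inl α) (Sum.inl γ) = 0 := fun z hz => by
  have hLc : 1 ≤ Lc := one_le_of_neZero Lc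
  rw [Pi.smul_apply, Pi.smul_apply, Pi.smul_apply, Pi.smul_apply, smul_eq_mul,
    dper_apply_of_siteCov hM (fun ρ y t => symHessFFAt_translate (ctr 4 Lc) ρ y t) ρ' w x z (Sum.inl α) (Sum.inl γ)]
  rw [(tsum_congr fun n => ?_).trans tsum_zero, mul_zero]
  rw [symHessFFAt_inl_inl, show ctr 4 Lc = toSite (ctrOff 4 Lc) from rfl]
  by_cases hx : Near Lc (translate M' w n) x
  · exact symHessKerAt_eq_zero_right (ctrOff_mem_box hLc) _ (f' := (γ, z))
      (fun hz' => hz (Finset.mem_image.2 ⟨x - z, sub_mem_cube_of_near_near hx hz', sub_sub_cancel x z⟩))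
  · exact symHessKerAt_eq_zero_left (ctrOff_mem_box hLc) (f := (α, x)) hx _

omit [∀ μ, NeZero (M μ)] in
/-- [folklore] **`sum_mixedT2per_even_sub_inl_inl` — THE FIRST-SLOT INDEX LAW OF THE COARSE-SLOT-PERIODISED EVEN MIXED BI-FAMILY** in the engine's `hlaw` shape on the
`(inl, inl)` block (`M = Lc·M′`): `Σ_κ (V κ (w₀ − e_κ) − V κ w₀) x z (inl α) (inl γ) = ([x = w₀] − [z = w₀]) · ((−wM2_j) • dper M (symHessFFAt ρ_c Lc ρ′ w)) x z (inl α) (inl γ)`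
— PART 25's `sum_mixedT2_even_sub_inl_inl` for each copy `w + M′∘n` of the multiplier bond, summed; `Σ'_n symHessFFAt ρ′ (w + M′∘n) = dper M (symHessFFAt ρ′ w)` (`dper_apply_of_siteCov`).
Both fluctuation legs rotate at their own sites; NO root contact, NO remainder. -/
theorem sum_mixedT2per_even_sub_inl_inl (hM : ∀ i, M i = Lc * M' i)
    (hV : V = fun κ u x z a c => ∑' n : Site 4,
      ((1 / 2 : ℝ) • (M2Of 3 Lc (symMixFFAt (ctr 4 Lc) Lc) j κ u ρ' (translate M' w n)
          + sgnK (trK (M2Of 3 Lc (symMixFFAt (ctr 4 Lc) Lc) j κ u ρ' (translate M' w n))))) x z a c)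
    (w₀ x z : Site 4) (α γ : Fin 4) :
    ∑ κ : Fin 4, (V κ (w₀ - unitVec κ) x z (Sum.inl α) (Sum.inl γ) - V κ w₀ x z (Sum.inl α) (Sum.inl γ))
      = ((if x = w₀ then (1 : ℝ) else 0) - (if z = w₀ then 1 else 0))
          * (((-wM2 3 Lc j) • dper M (symHessFFAt (ctr 4 Lc) Lc ρ' w)) x z (Sum.inl α) (Sum.inl γ)) := by
  subst hV
  -- termwise difference of two convergent copy sums, then the finite `κ`-sum inside the `n`-sum
  have hsum : ∀ κ : Fin 4,
      (∑' n : Site 4, ((1 / 2 : ℝ) • (M2Of 3 Lc (symMixFFAt (ctr 4 Lc) Lc) j κ (w₀ - unitVec κ) ρ' (translate M' w n)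
          + sgnK (trK (M2Of 3 Lc (symMixFFAt (ctr 4 Lc) Lc) j κ (w₀ - unitVec κ) ρ' (translate M' w n))))) x z (Sum.inl α) (Sum.inl γ))
        - (∑' n : Site 4, ((1 / 2 : ℝ) • (M2Of 3 Lc (symMixFFAt (ctr 4 Lc) Lc) j κ w₀ ρ' (translate M' w n)
          + sgnK (trK (M2Of 3 Lc (symMixFFAt (ctr 4 Lc) Lc) j κ w₀ ρ' (translate M' w n))))) x z (Sum.inl α) (Sum.inl γ))
      = ∑' n : Site 4, (((1 / 2 : ℝ) • (M2Of 3 Lc (symMixFFAt (ctr 4 Lc) Lc) j κ (w₀ - unitVec κ) ρ' (translate M' w n)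
          + sgnK (trK (M2Of 3 Lc (symMixFFAt (ctr 4 Lc) Lc) j κ (w₀ - unitVec κ) ρ' (translate M' w n))))) x z (Sum.inl α) (Sum.inl γ)
          - ((1 / 2 : ℝ) • (M2Of 3 Lc (symMixFFAt (ctr 4 Lc) Lc) j κ w₀ ρ' (translate M' w n)
          + sgnK (trK (M2Of 3 Lc (symMixFFAt (ctr 4 Lc) Lc) j κ w₀ ρ' (translate M' w n))))) x z (Sum.inl α) (Sum.inl γ)) := fun κ =>
    ((summable_mixedT2_even_translate_inl_inl (M' := M') j ρ' w κ (w₀ - unitVec κ) x z α γ).tsum_sub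
      (summable_mixedT2_even_translate_inl_inl (M' := M') j ρ' w κ w₀ x z α γ)).symm
  simp only [hsum]
  rw [← Summable.tsum_finsetSum (fun κ _ => (summable_mixedT2_even_translate_inl_inl (M' := M') j ρ' w κ (w₀ - unitVec κ) x z α γ).sub
    (summable_mixedT2_even_translate_inl_inl (M' := M') j ρ' w κ w₀ x z α γ))]
  -- PART 25's (T2-M₂)ᵉ letter, copy by copy
  rw [tsum_congr fun n => sum_mixedT2_even_sub_inl_inl (Lc := Lc) j ρ' (translate M' w n) w₀ x z α γ, tsum_mul_left]
  congr 1
  rw [Pi.smul_apply, Pi.smul_apply, Pi.smul_apply, Pi.smul_apply, smul_eq_mul,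
    dper_apply_of_siteCov hM (fun ρ y t => symHessFFAt_translate (ctr 4 Lc) ρ y t) ρ' w x z (Sum.inl α) (Sum.inl γ), neg_mul, ← tsum_mul_left, ← tsum_neg]

end Family

/-! ## §3 (K2b) at depth 1 on the torus: the periodised even mixed bi-member along a torus pure gauge in its FINE bond (any box `M = Lc·M′`, any level `j`) -/

section Torus

variable {M M' : Fin 4 → ℕ} [∀ μ, NeZero (M μ)] [∀ μ, NeZero (M' μ)] (j : ℕ) (ρ' : Fin 4) (w : Site 4)
  {V : Fin 4 → Site 4 → MKer 4 (Fib 3)}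

/-- [folklore] **`sum_tgrad_mul_perZ_dper_mixedT2per_even` — ENTRYWISE** (an2's period-lattice engine `sum_tgrad_mul_perZ_dper_of_indexLaw_periodCov` fed §2's letters): for every torus
gauge parameter `s` and `ff` entry, `Σ_{u ∈ pbox M} Σ_κ tgrad M (u, inl κ) s · perZ M (dper M (V κ u)) x z (inl α) (inl γ)
= (tdelta M x s − tdelta M z s) · perZ M ((−wM2_j) • dper M (symHessFFAt ρ_c Lc ρ′ w)) x z (inl α) (inl γ)`. -/
theorem sum_tgrad_mul_perZ_dper_mixedT2per_even (hM : ∀ i, M i = Lc * M' i)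
    (hV : V = fun κ u x z a c => ∑' n : Site 4,
      ((1 / 2 : ℝ) • (M2Of 3 Lc (symMixFFAt (ctr 4 Lc) Lc) j κ u ρ' (translate M' w n)
          + sgnK (trK (M2Of 3 Lc (symMixFFAt (ctr 4 Lc) Lc) j κ u ρ' (translate M' w n))))) x z a c)
    (s : ↥(pbox M)) (x z : Site 4) (α γ : Fin 4) :
    ∑ u : ↥(pbox M), ∑ κ : Fin 4, tgrad M (u, Sum.inl κ) s * perZ M (dper M (V κ (u : Site 4))) x z (Sum.inl α) (Sum.inl γ)
      = (tdelta M x s - tdelta M z s) * perZ M ((-wM2 3 Lc j) • dper M (symHessFFAt (ctr 4 Lc) Lc ρ' w)) x z (Sum.inl α) (Sum.inl γ) :=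
  sum_tgrad_mul_perZ_dper_of_indexLaw_periodCov (M := M) V ((-wM2 3 Lc j) • dper M (symHessFFAt (ctr 4 Lc) Lc ρ' w)) (fun x => x)
    (fun x => (cube (3 + 1) (2 * Lc)).image (fun v => x - v)) (fun x => (cube (3 + 1) (2 * Lc)).image (fun v => x - v)) (Sum.inl α) (Sum.inl γ)
    (mixedT2per_even_periodCov j ρ' w hM hV) (fun κ u x => mixedT2per_even_inl_inl_eq_zero_of_not_mem_S j ρ' w hV κ u x α γ)
    (fun κ x z => mixedT2per_even_inl_inl_eq_zero_of_not_mem_T j ρ' w hV κ x z α γ)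
    (fun x => dper_symHessFFAt_inl_inl_eq_zero_of_not_mem ρ' w hM (-wM2 3 Lc j) x α γ)
    (fun w₀ x z => sum_mixedT2per_even_sub_inl_inl j ρ' w hM hV w₀ x z α γ) s x z

/-- [folklore] **`torus_M2even_pureGauge_fst` — MATRIX FORM ON THE `ff` BLOCK, ANY BOX `M = Lc·M′`** (the (K2b) row of J-NOTE-12 §3 at depth 1): with the torus even mixed bi-member
`ℳ₂ᵉ^{b,β} := (perF M (dper M (V b.2 ↑b.1)))|ff` (fine field bond `b` on the torus; coarse multiplier bond `β = (ρ′, w)` a lattice bond, its COARSE-period copies summed inside `V`)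
and the periodised constraint Hessian `Ĥ_β := (perF M (dper M (symHessFFAt ρ_c Lc ρ′ w)))|ff`, for every torus gauge parameter `s`:
`Σ_b tgrad M (b.1, inl b.2) s • ℳ₂ᵉ^{b,β} = wM2_j • (Ĥ_β * E_s − E_s * Ĥ_β)`, `E_s := diagonal (tdelta M b.1 s)` — a PURE commutator, no remainder word, no Λ-lock. -/
theorem torus_M2even_pureGauge_fst (hM : ∀ i, M i = Lc * M' i)
    (hV : V = fun κ u x z a c => ∑' n : Site 4,
      ((1 / 2 : ℝ) • (M2Of 3 Lc (symMixFFAt (ctr 4 Lc) Lc) j κ u ρ' (translate M' w n)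
          + sgnK (trK (M2Of 3 Lc (symMixFFAt (ctr 4 Lc) Lc) j κ u ρ' (translate M' w n))))) x z a c)
    (s : ↥(pbox M)) :
    (∑ b : ↥(pbox M) × Fin 4, tgrad M (b.1, Sum.inl b.2) s •
        (perF M (dper M (V b.2 (b.1 : Site 4)))).submatrix
          (fun b : ↥(pbox M) × Fin 4 => ((b.1, Sum.inl b.2) : Idx M (Fib 3)))
          (fun b : ↥(pbox M) × Fin 4 => ((b.1, Sum.inl b.2) : Idx M (Fib 3))))
      = wM2 3 Lc j • ((perF M (dper M (symHessFFAt (ctr 4 Lc) Lc ρ' w))).submatrix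
            (fun b : ↥(pbox M) × Fin 4 => ((b.1, Sum.inl b.2) : Idx M (Fib 3)))
            (fun b : ↥(pbox M) × Fin 4 => ((b.1, Sum.inl b.2) : Idx M (Fib 3)))
          * Matrix.diagonal (fun b : ↥(pbox M) × Fin 4 => tdelta M (b.1 : Site 4) s)
        - Matrix.diagonal (fun b : ↥(pbox M) × Fin 4 => tdelta M (b.1 : Site 4) s)
          * (perF M (dper M (symHessFFAt (ctr 4 Lc) Lc ρ' w))).submatrix
            (fun b : ↥(pbox M) × Fin 4 => ((b.1, Sum.inl b.2) : Idx M (Fib 3)))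
            (fun b : ↥(pbox M) × Fin 4 => ((b.1, Sum.inl b.2) : Idx M (Fib 3)))) := by
  ext x z
  rw [Matrix.sum_apply, Matrix.smul_apply, Matrix.sub_apply, Matrix.diagonal_mul, Matrix.mul_diagonal, smul_eq_mul]
  simp only [Matrix.smul_apply, Matrix.submatrix_apply, perF_apply, smul_eq_mul]
  rw [Fintype.sum_prod_type, sum_tgrad_mul_perZ_dper_mixedT2per_even (M := M) (M' := M') j ρ' w hM hV s _ _ x.2 z.2, perZ_smul]
  simp only [Pi.smul_apply, smul_eq_mul]
  ring

/-- [folklore] **`torus_M2even_pureGauge_fst_fun` — ALONG ANY TORUS GAUGE FUNCTION** `λ : ↥(pbox M) → ℝ` (`(Dλ)_b := Σ_s tgrad M (b.1, inl b.2) s · λ s`):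
`Σ_b (Dλ)_b • ℳ₂ᵉ^{b,β} = wM2_j • (Ĥ_β * E_λ − E_λ * Ĥ_β)`, `E_λ := diagonal (fun b => λ b.1)` — (K2b) of J-NOTE-12 §3 at depth 1: `κ₂ = −wM2_j` against `[E_λ, Ĥ_β]` (`wM2_0 = 1`). -/
theorem torus_M2even_pureGauge_fst_fun (hM : ∀ i, M i = Lc * M' i)
    (hV : V = fun κ u x z a c => ∑' n : Site 4,
      ((1 / 2 : ℝ) • (M2Of 3 Lc (symMixFFAt (ctr 4 Lc) Lc) j κ u ρ' (translate M' w n)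
          + sgnK (trK (M2Of 3 Lc (symMixFFAt (ctr 4 Lc) Lc) j κ u ρ' (translate M' w n))))) x z a c)
    (lam : ↥(pbox M) → ℝ) :
    (∑ b : ↥(pbox M) × Fin 4, (∑ s : ↥(pbox M), tgrad M (b.1, Sum.inl b.2) s * lam s) •
        (perF M (dper M (V b.2 (b.1 : Site 4)))).submatrix
          (fun b : ↥(pbox M) × Fin 4 => ((b.1, Sum.inl b.2) : Idx M (Fib 3)))
          (fun b : ↥(pbox M) × Fin 4 => ((b.1, Sum.inl b.2) : Idx M (Fib 3))))
      = wM2 3 Lc j • ((perF M (dper M (symHessFFAt (ctr 4 Lc) Lc ρ' w))).submatrix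
            (fun b : ↥(pbox M) × Fin 4 => ((b.1, Sum.inl b.2) : Idx M (Fib 3)))
            (fun b : ↥(pbox M) × Fin 4 => ((b.1, Sum.inl b.2) : Idx M (Fib 3)))
          * Matrix.diagonal (fun b : ↥(pbox M) × Fin 4 => lam b.1)
        - Matrix.diagonal (fun b : ↥(pbox M) × Fin 4 => lam b.1)
          * (perF M (dper M (symHessFFAt (ctr 4 Lc) Lc ρ' w))).submatrix
            (fun b : ↥(pbox M) × Fin 4 => ((b.1, Sum.inl b.2) : Idx M (Fib 3)))
            (fun b : ↥(pbox M) × Fin 4 => ((b.1, Sum.inl b.2) : Idx M (Fib 3)))) := by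
  have hswap : (∑ b : ↥(pbox M) × Fin 4, (∑ s : ↥(pbox M), tgrad M (b.1, Sum.inl b.2) s * lam s) •
        (perF M (dper M (V b.2 (b.1 : Site 4)))).submatrix
          (fun b : ↥(pbox M) × Fin 4 => ((b.1, Sum.inl b.2) : Idx M (Fib 3)))
          (fun b : ↥(pbox M) × Fin 4 => ((b.1, Sum.inl b.2) : Idx M (Fib 3))))
      = ∑ s : ↥(pbox M), lam s • ∑ b : ↥(pbox M) × Fin 4, tgrad M (b.1, Sum.inl b.2) s •
        (perF M (dper M (V b.2 (b.1 : Site 4)))).submatrix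
          (fun b : ↥(pbox M) × Fin 4 => ((b.1, Sum.inl b.2) : Idx M (Fib 3)))
          (fun b : ↥(pbox M) × Fin 4 => ((b.1, Sum.inl b.2) : Idx M (Fib 3))) := by
    simp only [Finset.sum_smul, Finset.smul_sum, smul_smul, mul_comm (lam _)]
    exact Finset.sum_comm
  rw [hswap, Finset.sum_congr rfl fun s _ => by rw [torus_M2even_pureGauge_fst j ρ' w hM hV s]]
  ext x z
  simp only [Matrix.sum_apply, Matrix.smul_apply, Matrix.sub_apply, Matrix.diagonal_mul, Matrix.mul_diagonal, smul_eq_mul]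
  rw [show lam z.1 = ∑ s : ↥(pbox M), tdelta M ((z.1 : ↥(pbox M)) : Site 4) s * lam s by rw [sum_tdelta_mul, wrapPt_of_mem],
    show lam x.1 = ∑ s : ↥(pbox M), tdelta M ((x.1 : ↥(pbox M)) : Site 4) s * lam s by rw [sum_tdelta_mul, wrapPt_of_mem]]
  simp only [Finset.mul_sum, Finset.sum_mul, mul_sub, Finset.sum_sub_distrib]
  congr 1 <;> exact Finset.sum_congr rfl fun s _ => by ring

end Torus

end Summit.QuantumFields.BalabanUV.Beta.CombMixedT2EvenPeriodised

end
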